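import Mathlib
import Literature.NumberTheory.Automorphic.HilbertModularFormQExpansion
import Summits.Langlands.Langlands.Theorems.CapacityClassicalityHilbertIntegralOverconvergentIsCongruenceKoecherGlue
import Summits.Langlands.Langlands.Theorems.CapacityClassicalityHilbertIntegralOverconvergentIsCongruenceStubSlashMul
import Summits.Langlands.Langlands.Theorems.CapacityClassicalityHilbertIntegralOverconvergentIsCongruenceKoecherPrinciple
import Summits.Langlands.Langlands.Theorems.CapacityClassicalityHilbertIntegralOverconvergentIsCongruenceStubHolNoZeroDivisors
import Summits.Langlands.Langlands.Theorems.CapacityClassicalityHilbertIntegralOverconvergentIsCongruenceStubGamma1Decomposition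
import Summits.Langlands.Langlands.Theorems.CapacityClassicalityHilbertIntegralOverconvergentIsCongruenceStubGamma1FiniteIndex
import Summits.Langlands.Langlands.Theorems.CapacityClassicalityHilbertIntegralOverconvergentIsCongruenceStubTransferFunctions

/-!
# Algebraic over Hilbert modular forms ⇒ modular; `q`-series algebraic over Hilbert modular forms are modular forms
# with the prescribed `q`-expansion (section N endpoints)

Endpoints of RESHAPE 10 (section N) of line Sketch-ideate-r1-k1 for the crux `HilbertIntegralOverconvergentIsCongruence`
(stmt-Langlands-8485), in the vocabulary `Literature.NumberTheory.Automorphic.HilbertModular` — the idea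
`csp-koecher-collapse` in full, UNCONDITIONAL (Serre's congruence subgroup property and the Götzky–Koecher principle are
theorems of the tree):

* `algebraicIsModular` — for `F` totally real, `[F:ℚ] ≥ 2`, a holomorphic `𝓞 F`-periodic `g` on `ℍ` (`0` off `ℍ`) satisfying
  a non-trivial relation `∑_{j ≤ D} F_j g^j = 0` with `F_j ∈ M_{b_j}(Γ₁(𝔫))`, `b_j + jk = b_0`, `𝔫 ≠ 0`, lies in
  `M_k(Γ₁(𝔪))` for some `𝔪 ≠ 0` (`stub_transfer_functions` = the abstract transfer on the domain of holomorphic functions,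
  `stub_hol_noZeroDivisors`, `stub_gamma1_finiteIndex`; `Γ₁(𝔪) = T(𝓞 F)Γ(𝔪)`, `stub_gamma1_decomposition`; the Koecher
  principle `koecherPrinciple`);
* `qSeries_mem_modularForms_of_algebraic` — the same for a `q`-series `∑_{ν ∈ 𝔡⁻¹} c_ν e^{2πi S(νz)}` with
  `∑ |c_ν| e^{-2π⟨ν,y⟩} < ∞` at all heights (`qSeriesPackage` supplies holomorphy and periodicity), together with the
  identification of its Fourier coefficients: `fourierCoeffAt = c`.  This is the repaired crux C′ MODULO THE OUTPUT OF THE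
  ALGEBRAIZATION ENGINE (the non-trivial relation), for one complex embedding at a time.
-/

set_option linter.dupNamespace false

noncomputable section

namespace Summit.Langlands.Langlands.Theorems.HilbertIntegralOverconvergentIsCongruence

open MeasureTheory Complex NumberField
open Literature.NumberTheory.Automorphic Literature.NumberTheory.Automorphic.HilbertModular
open scoped MatrixGroups

variable {F : Type} [Field F] [NumberField F]

omit [NumberField F] in
/-- The image in `SL₂(F)` of an integral translation matrix is the translation matrix. -/
theorem aim_coe_toSL2F_transl {t : SL(2, 𝓞 F)} {b : 𝓞 F} (ht : (t : Matrix (Fin 2) (Fin 2) (𝓞 F)) = !![1, b; 0, 1]) :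
    ((toSL2F t : SL(2, F)) : Matrix (Fin 2) (Fin 2) F) = !![1, (b : F); 0, 1] := by
  have h : ∀ i j, t i j = !![(1 : 𝓞 F), b; 0, 1] i j := fun i j ↦ by rw [← ht]
  ext i j
  rw [Matrix.SpecialLinearGroup.map_apply_coe, RingHom.mapMatrix_apply, Matrix.map_apply, h i j]
  fin_cases i <;> fin_cases j <;> simp

/-- **Algebraic over Hilbert modular forms ⇒ modular** (unconditional): for `F` totally real of degree `≥ 2`, a holomorphic
`𝓞 F`-periodic `g` on `ℍ`, `0` off `ℍ`, which satisfies a non-trivial polynomial relation with Hilbert-modular-form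
coefficients of level `Γ₁(𝔫)`, `𝔫 ≠ 0`, and weights `b_j + jk = b_0`, is a Hilbert modular form of weight `k` on `Γ₁(𝔪)` for
some `𝔪 ≠ 0`. [folklore] -/
theorem algebraicIsModular (F : Type) [Field F] [NumberField F] [NumberField.IsTotallyReal F]
    (hd : 1 < Module.finrank ℚ F) (𝔫 : Ideal (𝓞 F)) (h𝔫 : 𝔫 ≠ ⊥) (k : (F →+* ℝ) → ℤ) (D : ℕ)
    (b : ℕ → (F →+* ℝ) → ℤ) (hb : ∀ j ≤ D, b j + j • k = b 0)
    (Fm : ℕ → Point F → ℂ) (hFm : ∀ j ≤ D, Fm j ∈ modularForms (Bianchi.Gamma1 𝔫) (b j))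
    (hFm0 : ∃ j ≤ D, ∃ z ∈ halfSpace F, Fm j z ≠ 0)
    (g : Point F → ℂ) (hg : IsHolomorphicOn F g) (hzero : ∀ z ∉ halfSpace F, g z = 0)
    (hper : ∀ (a : 𝓞 F) (z : Point F), z ∈ halfSpace F → g (fun σ ↦ z σ + ((σ (a : F) : ℝ) : ℂ)) = g z)
    (hrel : ∀ z ∈ halfSpace F, ∑ j ∈ Finset.range (D + 1), Fm j z * g z ^ j = 0) :
    ∃ 𝔪 : Ideal (𝓞 F), 𝔪 ≠ ⊥ ∧ g ∈ modularForms (Bianchi.Gamma1 𝔪) k := by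
  obtain ⟨𝔪, h𝔪, hlaw⟩ := stub_transfer_functions F hd (stub_hol_noZeroDivisors F) 𝔫
    (stub_gamma1_finiteIndex F 𝔫 h𝔫) k D b hb Fm hFm hFm0 g hg hrel
  refine ⟨𝔪, h𝔪, ?_⟩
  have hlaw1 : ∀ γ ∈ Bianchi.Gamma1 𝔪, ∀ z ∈ halfSpace F,
      g (moeb (toSL2F γ) z) = autFactor k (toSL2F γ) z * g z := by
    intro γ hγ z hz
    obtain ⟨a, t, γ', ht, hγ', rfl⟩ := stub_gamma1_decomposition F 𝔪 γ hγ
    obtain ⟨hγ'z, hmoeb, haut, -⟩ := stub_slash_mul F k (toSL2F t) (toSL2F γ') g z hz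
    obtain ⟨htm, hta⟩ := kp_moeb_transl (aim_coe_toSL2F_transl ht) k (moeb (toSL2F γ') z)
    rw [map_mul, hmoeb, haut, htm, hta, one_mul, hper a _ hγ'z, hlaw γ' hγ' z hz]
  exact koecherPrinciple F hd 𝔪 h𝔪 (Bianchi.Gamma1 𝔪) (Bianchi.Gamma_le_Gamma1 𝔪) k g hg hlaw1 hzero

/-- **`q`-series algebraic over Hilbert modular forms are modular forms with the prescribed `q`-expansion** — the repaired
crux C′ modulo the output of the algebraization engine, for one complex embedding: for `F` totally real of degree `≥ 2` and
coefficients `c : F → ℂ` with `∑_{ν ∈ 𝔡⁻¹} |c_ν| e^{-2π⟨ν,y⟩} < ∞` at every height, let `g` be the `q`-series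
`∑_{ν ∈ 𝔡⁻¹} c_ν e^{2πi S(νz)}` on `ℍ` (and `0` off `ℍ`).  If `g` satisfies a non-trivial relation `∑_{j ≤ D} F_j g^j = 0` on `ℍ`
with `F_j ∈ M_{b_j}(Γ₁(𝔫))`, `b_j + jk = b_0`, `𝔫 ≠ 0`, then `g ∈ M_k(Γ₁(𝔪))` for some `𝔪 ≠ 0`, and its Fourier
coefficients are the `c_ν`. [folklore] -/
theorem qSeries_mem_modularForms_of_algebraic (F : Type) [Field F] [NumberField F] [NumberField.IsTotallyReal F]
    (hd : 1 < Module.finrank ℚ F) (c : F → ℂ)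
    (habs : ∀ y : (F →+* ℝ) → ℝ, (∀ σ, 0 < y σ) →
      Summable (fun ν : {ν : F | ∀ b : 𝓞 F, ∃ n : ℤ, Algebra.trace ℚ F (ν * b) = n} ↦
        ‖c ν‖ * Real.exp (-(2 * Real.pi * ∑ σ : F →+* ℝ, σ (ν : F) * y σ))))
    (g : Point F → ℂ)
    (hg : ∀ z ∈ halfSpace F, g z = ∑' ν : {ν : F | ∀ b : 𝓞 F, ∃ n : ℤ, Algebra.trace ℚ F (ν * b) = n},
      c ν * cexp (2 * Real.pi * I * pairing (ν : F) z))
    (hzero : ∀ z ∉ halfSpace F, g z = 0)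
    (𝔫 : Ideal (𝓞 F)) (h𝔫 : 𝔫 ≠ ⊥) (k : (F →+* ℝ) → ℤ) (D : ℕ)
    (b : ℕ → (F →+* ℝ) → ℤ) (hb : ∀ j ≤ D, b j + j • k = b 0)
    (Fm : ℕ → Point F → ℂ) (hFm : ∀ j ≤ D, Fm j ∈ modularForms (Bianchi.Gamma1 𝔫) (b j))
    (hFm0 : ∃ j ≤ D, ∃ z ∈ halfSpace F, Fm j z ≠ 0)
    (hrel : ∀ z ∈ halfSpace F, ∑ j ∈ Finset.range (D + 1), Fm j z * g z ^ j = 0) :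
    (∃ 𝔪 : Ideal (𝓞 F), 𝔪 ≠ ⊥ ∧ g ∈ modularForms (Bianchi.Gamma1 𝔪) k) ∧
      ∀ ν : F, (∀ b : 𝓞 F, ∃ n : ℤ, Algebra.trace ℚ F (ν * b) = n) →
        ∀ y : (F →+* ℝ) → ℝ, (∀ σ, 0 < y σ) → fourierCoeffAt g ν y = c ν := by
  obtain ⟨hhol, hperq, hcoef⟩ := qSeriesPackage F c habs
  set q : Point F → ℂ := fun z ↦ ∑' ν : {ν : F | ∀ b : 𝓞 F, ∃ n : ℤ, Algebra.trace ℚ F (ν * b) = n},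
      c ν * cexp (2 * Real.pi * I * pairing (ν : F) z) with hqdef
  have hgq : Set.EqOn g q (halfSpace F) := fun z hz ↦ hg z hz
  have hg_hol : IsHolomorphicOn F g := (hhol.congr hgq)
  have hg_per : ∀ (a : 𝓞 F) (z : Point F), z ∈ halfSpace F → g (fun σ ↦ z σ + ((σ (a : F) : ℝ) : ℂ)) = g z := by
    intro a z hz
    have hz' : (fun σ ↦ z σ + ((σ (a : F) : ℝ) : ℂ)) ∈ halfSpace F := fun σ ↦ by simpa using hz σ
    rw [hg _ hz', hg z hz]
    exact hperq a z hz
  refine ⟨algebraicIsModular F hd 𝔫 h𝔫 k D b hb Fm hFm hFm0 g hg_hol hzero hg_per hrel, fun ν hν y hy ↦ ?_⟩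
  -- the Fourier coefficients only see the values on `ℍ`
  have hcoefg : fourierCoeffAt g ν y = fourierCoeffAt q ν y := by
    refine setIntegral_congr_fun measurableSet_Icc fun x _ ↦ ?_
    rw [hg _ (koe_cubePoint_mem_halfSpace x hy)]
  rw [hcoefg]
  exact hcoef ν hν y hy

end Summit.Langlands.Langlands.Theorems.HilbertIntegralOverconvergentIsCongruence
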